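/-
Copyright (c) 2026 the pub-hodgecm-mathlib formalisation cell (harness21).  Prover seat hodgecm-mathlib-F0P3a-p09 (g9); dealer LH4-plan (g7) WORD #10 R3 «LAYER C (C3a)»,
2026-09-02.  Count-neutral base layer of the dyadic (D-UNR) column (FINDINGS #6∕#6′ of the LH4 board); CENSUS-C3-BorelCountsTrace 9b5d35604f8b6f1d §1∕§2.
-/
import Literature.NumberTheory.Automorphic.UnitaryThreeDoubleCosetsHKStabilizerTrace   -- ★ p851832 LAYER B 2∕3: `u_m^{(y,z)}` conjugates, `flickerU_of_rel_inv_mul_mul_mem_unitaryInt_iff`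
import HarnessLib

/-!
# Flicker's Prop. 10 ∕ 13 congruences for `p⁻¹ τ p`, `p ∈ P_H`, in the TRACE FRAME (every residue characteristic): the general-corner conjugate,
# the `H^K_m`-membership criterion over `u_m^{(y,z)}`, its `(ν, w)` normal form, and the regimes

Topic `NumberTheory/Automorphic`; namespace `Literature.NumberTheory.Automorphic.UnitaryGroup`.  THEOREMS ONLY (no definition, no instance, no notation, no
named fact, no `sorry`); kernel lane.  Cell `pub/hodgecm-mathlib`, crux H413 = `stmt-HodgeConjecture-24833`; LAYER C block **(C3a)** of the (D-UNR) type-(1)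
column (dealer LH4-plan (g7) WORD #10 R3; design census `F0/P3a/F0P3a-p09/g9/c3/CENSUS-C3-BorelCountsTrace.v1.md` sha16 9b5d35604f8b6f1d §0.2∕§1∕§2, this
seat; CENSUS-R1 52a4c879 §0.2 (b) (LH4-p03 g8); CENSUS-LAYERB-3of3 4277d501 §4 (LH3-p02 g6); FINDING #6′).  Twin of ★
`Automorphic/UnitaryThreeBorelConjugateCongruences` (Flicker's SYMMETRIC torus shape `!![A,0,B₁;0,b,0;B₂,0,A]`, `A = (a+c)∕2`, level element `u_m` with
`y·σy = −2`, datum `LocalConjDatum` with `|2| = 1`) WITHOUT any of the three: the torus corner is general (`A ≠ D` allowed — the trace-frame literal has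
`A = x₁σb₀ + x₃b₀`, `D = x₁b₀ + x₃σb₀`), the level element is ★ LAYER B 1∕3's `u_m^{(y,z)}` (`z + σz + yσy = 0`, `|y| = 1`; trace instance `(1, −b₀)`), the
datum is ★ `UnramifiedLocalConjDatum`.

THE MATHEMATICS [Flicker1998UnitaryFL, Prop. 10 pp. 85–86, in the tree's Φ₃ frame, re-read].  For `p = !![u,0,u·x;0,w,0;0,0,(σu)⁻¹]` (`σx = −x`,
`ν := uσu`) and `τ = !![A,0,B₁;0,b,0;B₂,0,D]`: `p⁻¹τp = !![A − xνB₂, 0, ν⁻¹B₁ + x(A−D) − x²νB₂; 0,b,0; νB₂, 0, D + xνB₂]` (§1′).  Feeding this block into ★ 2∕3's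
criterion for `u = u_m^{(y,z)}` (stated there for a GENERAL block `!![α,0,β;0,e,0;γ,0,δ]`) gives (§2′) the four conditions
(1′) `|νB₂| ≤ 1`, (2′) `|A − b + νB₂(σz − x)| ≤ |t|`, (3′) `|D − b + νB₂(x + z)| ≤ |t|`,
(4′) `|ν⁻¹B₁ + (A−b)(x+z) + (D−b)(σz−x) + νB₂(x+z)(σz−x)| ≤ |t|²` (`t = ϖ^m`) — Flicker's «four equations» are the instance `z = 1`, `D = A`
(`(2)(3) = |A − b + νB₂(1 ∓ x)|`, `(4) = |2(A−b) + B₁ν⁻¹ + νB₂(1−x²)|`).  In the variable **`w := x + z`** (`σw = σz − x`; `w + σw = z + σz = −yσy` is a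
σ-fixed UNIT — the trace fibre) these read (2′) `|A − b + νB₂σw| ≤ |t|`, (3′) `|D − b + νB₂w| ≤ |t|`, (4′) `|ν⁻¹B₁ + (A−b)w + (D−b)σw + νB₂·wσw| ≤ |t|²`
(§3′: the norm `N(w) = wσw` appears by itself; nothing is halved), and the regime analysis of ★ §4 re-derives in `(ν, w)` with `1 − x² ↦ N(w)` (a unit because
`|w| ≤ 1` and `|w + σw| = 1`, §3′) and `2(A−b) ↦ (A−b)w + (D−b)σw` (§4′).  What is NOT here: the equal-size case `|A−b| = |D−b| > |B₂|` and the `j = 0`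
near∕bounded∕high trichotomy (they read the literal through `|σb₀ − b₀| = 1`, token T7 — block (C3b)), and every COUNT (blocks (C3c)–(C3e)).
HONEST LABEL: HC_CM is proved only modulo the printed citations (hLiu418 = `stmt-HodgeConjecture-24832`, h413 = `stmt-HodgeConjecture-24833`) until rung 0
closes; (D-UNR) stays PRINT by D74′; this is valued-field matrix algebra, it pays no organ and opens no road.

## References
* [Flicker1998UnitaryFL] Y. Z. Flicker, *Elementary proof of the fundamental lemma for a unitary group*, Canad. J. Math. 50 (1998), 74–98: Prop. 4 p. 81 (`H^K_m`
  by congruences), Prop. 8 p. 84 (`P_H`), Prop. 10 pp. 85–86 (the four equations and the regimes), Prop. 13 p. 93.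
* [Rogawski1990] J. D. Rogawski, *Automorphic Representations of Unitary Groups in Three Variables* (1990), §4.9 p. 55 (the unit orbital integrals being computed).
-/

set_option autoImplicit false

open scoped MatrixGroups WithZero
open Matrix

namespace Literature.NumberTheory.Automorphic

namespace UnitaryGroup

open Literature.NumberTheory.Automorphic.HermitianLattice (unitaryInt mem_unitaryInt_iff UnramifiedLocalConjDatum)

variable {K : Type*} [Field K] [Valued K ℤᵐ⁰] {ϖ : K}
  (σ : K →+* K) {J : Matrix (Fin 3) (Fin 3) K} (hJ : J = (StdForm.antidiagonal 3).over K)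

/-! ## §1′ The conjugate `p⁻¹ τ p` for a general corner -/

omit [Valued K ℤᵐ⁰] in
/-- **`p⁻¹ τ p` for `p ∈ P_H·E¹` and `τ` a block element with a GENERAL corner** (Flicker p. 86 l. 3 is the case `D = A`): with
`p = !![u,0,u·x; 0,w,0; 0,0,(σu)⁻¹]`, `τ = !![A,0,B₁; 0,b,0; B₂,0,D]` and `ν = u·σu`,
`p⁻¹ τ p = !![A − xνB₂, 0, B₁ν⁻¹ + x(A − D) − x²νB₂; 0, b, 0; νB₂, 0, D + xνB₂]`. [cite: Flicker1998UnitaryFL, Prop. 10 p. 86] -/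
theorem coe_borel_inv_mul_mul_borel_gen {p τ : ↥(unitaryGroupOfForm σ J)} {u x w A B₁ B₂ D b : K} (hu : u ≠ 0) (hσu : σ u ≠ 0) (hw : w ≠ 0)
    (hp : ((p : GL (Fin 3) K) : Matrix (Fin 3) (Fin 3) K) = !![u, 0, u * x; 0, w, 0; 0, 0, (σ u)⁻¹])
    (hτ : ((τ : GL (Fin 3) K) : Matrix (Fin 3) (Fin 3) K) = !![A, 0, B₁; 0, b, 0; B₂, 0, D]) :
    (((p⁻¹ * τ * p : ↥(unitaryGroupOfForm σ J)) : GL (Fin 3) K) : Matrix (Fin 3) (Fin 3) K) =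
      !![A - x * (u * σ u) * B₂, 0, B₁ * (u * σ u)⁻¹ + x * (A - D) - x ^ 2 * (u * σ u) * B₂;
         0, b, 0;
         (u * σ u) * B₂, 0, D + x * (u * σ u) * B₂] := by
  -- `τ · p = p · R`, then cancel `p` on the left
  have key : ((τ : GL (Fin 3) K) : Matrix (Fin 3) (Fin 3) K) * ((p : GL (Fin 3) K) : Matrix (Fin 3) (Fin 3) K) =
      ((p : GL (Fin 3) K) : Matrix (Fin 3) (Fin 3) K) *
        !![A - x * (u * σ u) * B₂, 0, B₁ * (u * σ u)⁻¹ + x * (A - D) - x ^ 2 * (u * σ u) * B₂;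
           0, b, 0;
           (u * σ u) * B₂, 0, D + x * (u * σ u) * B₂] := by
    rw [hτ, hp]
    simp only [Matrix.mul_fin_three]
    ext i j
    fin_cases i <;> fin_cases j <;> simp only [Matrix.of_apply, Matrix.cons_val', Matrix.cons_val_zero, Matrix.cons_val_one,
      Matrix.cons_val_fin_one, Matrix.cons_val, Matrix.empty_val', Fin.mk_one, Fin.zero_eta, Fin.reduceFinMk, mul_zero, zero_mul,
      add_zero, zero_add]
    all_goals field_simp
    all_goals ring
  rw [Subgroup.coe_mul, Subgroup.coe_mul, Units.val_mul, Units.val_mul, Matrix.mul_assoc, key, ← Matrix.mul_assoc, Subgroup.coe_inv,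
    Units.inv_mul, Matrix.one_mul]

/-! ## §2′ `p⁻¹ τ p ∈ H^K_m` (`K^H_m = H ∩ u_m^{(y,z)} K₀ (u_m^{(y,z)})⁻¹`) as four valuation conditions -/

include hJ in
/-- **«`p⁻¹ τ p ∈ H^K_m`» in coordinates, trace frame** (`H^K_m = H ∩ u K₀ u⁻¹`, `u = u_m^{(y,z)}`, membership by ★ LAYER B 2∕3
`flickerU_of_rel_inv_mul_mul_mem_unitaryInt_iff`): for `p`, `τ` as in §1′, `|y| = 1`, `z + σz + yσy = 0`, `ν = uσu`, `t = ϖ^m`,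
`u⁻¹ (p⁻¹ τ p) u ∈ K₀ ↔ |νB₂| ≤ 1 ∧ |A − b + νB₂(σz − x)| ≤ |t| ∧ |D − b + νB₂(x + z)| ≤ |t| ∧ |B₁ν⁻¹ + (A−b)(x+z) + (D−b)(σz−x) + νB₂(x+z)(σz−x)| ≤ |t|²`.
Flicker's four equations (★ `borel_conj_mem_unitaryInt_iff`) are the instance `z = 1`, `D = A`. [cite: Flicker1998UnitaryFL, Prop. 10 pp. 85–86; Prop. 4 p. 81] -/
theorem borel_conj_mem_unitaryInt_iff_of_rel (hd : UnramifiedLocalConjDatum σ ϖ) {y z : K} (hy : Valued.v y = 1)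
    (hz : z + σ z + y * σ y = 0) (m : ℕ)
    {um p τ : ↥(unitaryGroupOfForm σ J)} {u x w A B₁ B₂ D b : K} (hu : u ≠ 0) (hσu : σ u ≠ 0) (hw : w ≠ 0)
    (hum : ((um : GL (Fin 3) K) : Matrix (Fin 3) (Fin 3) K) = !![ϖ ^ m, y, z * (ϖ ^ m)⁻¹; 0, 1, -σ y * (ϖ ^ m)⁻¹; 0, 0, (ϖ ^ m)⁻¹])
    (hp : ((p : GL (Fin 3) K) : Matrix (Fin 3) (Fin 3) K) = !![u, 0, u * x; 0, w, 0; 0, 0, (σ u)⁻¹])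
    (hτ : ((τ : GL (Fin 3) K) : Matrix (Fin 3) (Fin 3) K) = !![A, 0, B₁; 0, b, 0; B₂, 0, D]) :
    um⁻¹ * (p⁻¹ * τ * p) * um ∈ unitaryInt σ J ↔
      Valued.v ((u * σ u) * B₂) ≤ 1 ∧
      Valued.v (A - b + (u * σ u) * B₂ * (σ z - x)) ≤ Valued.v (ϖ ^ m) ∧
      Valued.v (D - b + (u * σ u) * B₂ * (x + z)) ≤ Valued.v (ϖ ^ m) ∧
      Valued.v (B₁ * (u * σ u)⁻¹ + (A - b) * (x + z) + (D - b) * (σ z - x) + (u * σ u) * B₂ * ((x + z) * (σ z - x))) ≤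
        Valued.v (ϖ ^ m) * Valued.v (ϖ ^ m) := by
  have hconj := coe_borel_inv_mul_mul_borel_gen σ hu hσu hw hp hτ
  rw [flickerU_of_rel_inv_mul_mul_mem_unitaryInt_iff σ hJ hd hy hz m hum hconj]
  have e2 : A - x * (u * σ u) * B₂ - b + u * σ u * B₂ * σ z = A - b + (u * σ u) * B₂ * (σ z - x) := by ring
  have e3 : u * σ u * B₂ * z + (D + x * (u * σ u) * B₂) - b = D - b + (u * σ u) * B₂ * (x + z) := by ring
  have e4 : B₁ * (u * σ u)⁻¹ + x * (A - D) - x ^ 2 * (u * σ u) * B₂ + z * (A - x * (u * σ u) * B₂ - b) +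
      σ z * (u * σ u * B₂ * z + (D + x * (u * σ u) * B₂) - b) =
      B₁ * (u * σ u)⁻¹ + (A - b) * (x + z) + (D - b) * (σ z - x) + (u * σ u) * B₂ * ((x + z) * (σ z - x)) := by ring
  rw [e4, e2, e3]

include hJ in
/-- **The trace-frame instance `(y, z) = (1, −b₀)`** (`b₀ + σb₀ = 1`, the trace-one integer of ★ `UnramifiedLocalConjDatum.trace`; `u = !![ϖ^m, 1, −b₀ϖ^{−m}; 0, 1, −ϖ^{−m};
0, 0, ϖ^{−m}]`): `u⁻¹(p⁻¹τp)u ∈ K₀ ↔ |νB₂| ≤ 1 ∧ |A − b − νB₂(σb₀ + x)| ≤ |t| ∧ |D − b + νB₂(x − b₀)| ≤ |t| ∧ |B₁ν⁻¹ + (A−b)(x−b₀) − (D−b)(σb₀ + x) − νB₂(x−b₀)(σb₀+x)| ≤ |t|²`.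
[cite: Flicker1998UnitaryFL, Prop. 10 pp. 85–86; Prop. 4 p. 81] -/
theorem borel_conj_mem_unitaryInt_iff_trace (hd : UnramifiedLocalConjDatum σ ϖ) {b₀ : K} (hb₀ : b₀ + σ b₀ = 1) (m : ℕ)
    {um p τ : ↥(unitaryGroupOfForm σ J)} {u x w A B₁ B₂ D b : K} (hu : u ≠ 0) (hσu : σ u ≠ 0) (hw : w ≠ 0)
    (hum : ((um : GL (Fin 3) K) : Matrix (Fin 3) (Fin 3) K) = !![ϖ ^ m, 1, -b₀ * (ϖ ^ m)⁻¹; 0, 1, -(ϖ ^ m)⁻¹; 0, 0, (ϖ ^ m)⁻¹])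
    (hp : ((p : GL (Fin 3) K) : Matrix (Fin 3) (Fin 3) K) = !![u, 0, u * x; 0, w, 0; 0, 0, (σ u)⁻¹])
    (hτ : ((τ : GL (Fin 3) K) : Matrix (Fin 3) (Fin 3) K) = !![A, 0, B₁; 0, b, 0; B₂, 0, D]) :
    um⁻¹ * (p⁻¹ * τ * p) * um ∈ unitaryInt σ J ↔
      Valued.v ((u * σ u) * B₂) ≤ 1 ∧
      Valued.v (A - b - (u * σ u) * B₂ * (σ b₀ + x)) ≤ Valued.v (ϖ ^ m) ∧
      Valued.v (D - b + (u * σ u) * B₂ * (x - b₀)) ≤ Valued.v (ϖ ^ m) ∧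
      Valued.v (B₁ * (u * σ u)⁻¹ + (A - b) * (x - b₀) - (D - b) * (σ b₀ + x) - (u * σ u) * B₂ * ((x - b₀) * (σ b₀ + x))) ≤
        Valued.v (ϖ ^ m) * Valued.v (ϖ ^ m) := by
  have hz : (-b₀) + σ (-b₀) + 1 * σ 1 = 0 := by rw [map_neg, map_one]; linear_combination -hb₀
  have hy : Valued.v (1 : K) = 1 := map_one _
  have hum' : ((um : GL (Fin 3) K) : Matrix (Fin 3) (Fin 3) K) =
      !![ϖ ^ m, 1, (-b₀) * (ϖ ^ m)⁻¹; 0, 1, -σ 1 * (ϖ ^ m)⁻¹; 0, 0, (ϖ ^ m)⁻¹] := by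
    rw [hum, map_one]; congr 1; ext i j; fin_cases i <;> fin_cases j <;> simp
  rw [borel_conj_mem_unitaryInt_iff_of_rel σ hJ hd hy hz m hu hσu hw hum' hp hτ, map_neg]
  have e2 : A - b + u * σ u * B₂ * (-σ b₀ - x) = A - b - (u * σ u) * B₂ * (σ b₀ + x) := by ring
  have e3 : D - b + u * σ u * B₂ * (x + -b₀) = D - b + (u * σ u) * B₂ * (x - b₀) := by ring
  have e4 : B₁ * (u * σ u)⁻¹ + (A - b) * (x + -b₀) + (D - b) * (-σ b₀ - x) + u * σ u * B₂ * ((x + -b₀) * (-σ b₀ - x)) =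
      B₁ * (u * σ u)⁻¹ + (A - b) * (x - b₀) - (D - b) * (σ b₀ + x) - (u * σ u) * B₂ * ((x - b₀) * (σ b₀ + x)) := by ring
  rw [e2, e3, e4]

/-! ## §3′ The `(ν, w)` normal form: `w := x + z`, `σw = σz − x`, `N(w) = wσw` a unit -/

omit [Valued K ℤᵐ⁰] in
/-- `σ(x + z) = σz − x` for `σx = −x`. [cite: Flicker1998UnitaryFL, Prop. 10 p. 86] -/
theorem map_add_eq_of_skew {x z : K} (hσx : σ x = -x) : σ (x + z) = σ z - x := by
  rw [map_add, hσx]; ring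

/-- **`|w| = 1` from the trace**: if `|w| ≤ 1`, `σ` is isometric and `|w + σw| = 1`, then `|w| = 1` (otherwise `|w + σw| ≤ |w| < 1`). [cite: Flicker1998UnitaryFL, Prop. 10 p. 86] -/
theorem v_eq_one_of_trace_unit (hσv : ∀ z, Valued.v (σ z) = Valued.v z) {w : K} (hwv : Valued.v w ≤ 1) (htr : Valued.v (w + σ w) = 1) :
    Valued.v w = 1 := by
  refine le_antisymm hwv (not_lt.1 fun hlt => ?_)
  have h : Valued.v (w + σ w) < 1 := lt_of_le_of_lt (Valuation.map_add _ _ _) (max_lt hlt (by rwa [hσv]))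
  rw [htr] at h
  exact lt_irrefl _ h

/-- **The norm `N(w) = w·σw` is a unit** when `|w| ≤ 1` and the trace `w + σw` is a unit — this replaces ★ `v_one_sub_sq_eq_one (h2 : |2| = 1)` (the tame case
`w = 1 + x`, `σw = 1 − x`, `N(w) = 1 − x²`, `Tr(w) = 2`). [cite: Flicker1998UnitaryFL, Prop. 10 p. 86] -/
theorem v_norm_eq_one_of_trace_unit (hσv : ∀ z, Valued.v (σ z) = Valued.v z) {w : K} (hwv : Valued.v w ≤ 1) (htr : Valued.v (w + σ w) = 1) :
    Valued.v (w * σ w) = 1 := by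
  have h1 := v_eq_one_of_trace_unit σ hσv hwv htr
  rw [map_mul, hσv, h1, one_mul]

omit [Valued K ℤᵐ⁰] in
/-- **Condition (4′) in the variable `w = x + z`**: `B₁ν⁻¹ + (A−b)(x+z) + (D−b)(σz−x) + νB₂(x+z)(σz−x) = B₁ν⁻¹ + (A−b)w + (D−b)σw + νB₂·wσw`. [cite: Flicker1998UnitaryFL, Prop. 10 p. 86] -/
theorem condition_four_eq_normForm {x z w ν A D b B₁ B₂ : K} (hσx : σ x = -x) (hw : w = x + z) :
    B₁ * ν⁻¹ + (A - b) * (x + z) + (D - b) * (σ z - x) + ν * B₂ * ((x + z) * (σ z - x)) =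
      B₁ * ν⁻¹ + (A - b) * w + (D - b) * σ w + ν * B₂ * (w * σ w) := by
  rw [hw, map_add_eq_of_skew σ hσx]

include hJ in
/-- **The criterion in `(ν, w)`** (`ν = uσu`, `w = x + z`): `u⁻¹(p⁻¹τp)u ∈ K₀ ↔ |νB₂| ≤ 1 ∧ |A − b + νB₂σw| ≤ |t| ∧ |D − b + νB₂w| ≤ |t| ∧
|B₁ν⁻¹ + (A−b)w + (D−b)σw + νB₂·wσw| ≤ |t|²` — no `½` anywhere; `w` ranges over the TRACE FIBRE `w + σw = −yσy`. [cite: Flicker1998UnitaryFL, Prop. 10 pp. 85–86] -/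
theorem borel_conj_mem_unitaryInt_iff_of_rel_normForm (hd : UnramifiedLocalConjDatum σ ϖ) {y z : K} (hy : Valued.v y = 1)
    (hz : z + σ z + y * σ y = 0) (m : ℕ)
    {um p τ : ↥(unitaryGroupOfForm σ J)} {u x w₀ A B₁ B₂ D b : K} (hu : u ≠ 0) (hσu : σ u ≠ 0) (hw₀ : w₀ ≠ 0) (hσx : σ x = -x)
    (hum : ((um : GL (Fin 3) K) : Matrix (Fin 3) (Fin 3) K) = !![ϖ ^ m, y, z * (ϖ ^ m)⁻¹; 0, 1, -σ y * (ϖ ^ m)⁻¹; 0, 0, (ϖ ^ m)⁻¹])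
    (hp : ((p : GL (Fin 3) K) : Matrix (Fin 3) (Fin 3) K) = !![u, 0, u * x; 0, w₀, 0; 0, 0, (σ u)⁻¹])
    (hτ : ((τ : GL (Fin 3) K) : Matrix (Fin 3) (Fin 3) K) = !![A, 0, B₁; 0, b, 0; B₂, 0, D]) {w : K} (hw : w = x + z) :
    um⁻¹ * (p⁻¹ * τ * p) * um ∈ unitaryInt σ J ↔
      Valued.v ((u * σ u) * B₂) ≤ 1 ∧
      Valued.v (A - b + (u * σ u) * B₂ * σ w) ≤ Valued.v (ϖ ^ m) ∧
      Valued.v (D - b + (u * σ u) * B₂ * w) ≤ Valued.v (ϖ ^ m) ∧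
      Valued.v (B₁ * (u * σ u)⁻¹ + (A - b) * w + (D - b) * σ w + (u * σ u) * B₂ * (w * σ w)) ≤ Valued.v (ϖ ^ m) * Valued.v (ϖ ^ m) := by
  rw [borel_conj_mem_unitaryInt_iff_of_rel σ hJ hd hy hz m hu hσu hw₀ hum hp hτ, condition_four_eq_normForm σ hσx hw, hw,
    map_add_eq_of_skew σ hσx]

/-! ## §4′ The regimes of Prop. 10 in `(ν, w)` (generic field elements; `t = ϖ^m`, `B₁ = B₂·p` with `|p| < 1` — ★'s `p = ϖ^{2j}`, `j ≥ 1`, and the `_gen` ratio at once) -/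

/-- **Regime «`m > ν` is empty»**: (2′)(3′)(4′) force `|B₂| ≤ |t|`.  Key identity `νB₂·wσw = B₁ν⁻¹ + (A − b + νB₂σw)·w + (D − b + νB₂w)·σw − Q`, every term on the
right `< |B₂|` if `|B₂| > |t|` (twin of ★ `v_B₂_le_of_conditions`, no `(2) ± (3)`). [cite: Flicker1998UnitaryFL, Prop. 10 p. 86] -/
theorem v_B₂_le_of_conditions_normForm (hd : UnramifiedLocalConjDatum σ ϖ) {A D b B₁ B₂ ν w p : K} {m : ℕ} (hB₂ : B₂ ≠ 0)
    (hν : Valued.v ν = 1) (hwv : Valued.v w ≤ 1) (hN : Valued.v (w * σ w) = 1) (hB₁ : B₁ = B₂ * p) (hvp : Valued.v p < 1)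
    (h₂ : Valued.v (A - b + ν * B₂ * σ w) ≤ Valued.v (ϖ ^ m)) (h₃ : Valued.v (D - b + ν * B₂ * w) ≤ Valued.v (ϖ ^ m))
    (h₄ : Valued.v (B₁ * ν⁻¹ + (A - b) * w + (D - b) * σ w + ν * B₂ * (w * σ w)) ≤ Valued.v (ϖ ^ m) * Valued.v (ϖ ^ m)) :
    Valued.v B₂ ≤ Valued.v (ϖ ^ m) := by
  have hν0 : ν ≠ 0 := fun h => by rw [h, map_zero] at hν; exact zero_ne_one hν
  have ht1 : Valued.v (ϖ ^ m) ≤ 1 := hd.v_pow_le_one m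
  have hσwv : Valued.v (σ w) ≤ 1 := by rw [hd.vσ]; exact hwv
  have h₄' : Valued.v (B₁ * ν⁻¹ + (A - b) * w + (D - b) * σ w + ν * B₂ * (w * σ w)) ≤ Valued.v (ϖ ^ m) :=
    le_trans h₄ (by simpa using mul_le_mul' ht1 (le_refl (Valued.v (ϖ ^ m))))
  have key : ν * B₂ * (w * σ w) = B₁ * ν⁻¹ + (A - b + ν * B₂ * σ w) * w + (D - b + ν * B₂ * w) * σ w -
      (B₁ * ν⁻¹ + (A - b) * w + (D - b) * σ w + ν * B₂ * (w * σ w)) := by ring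
  have hvB : Valued.v (ν * B₂ * (w * σ w)) = Valued.v B₂ := by rw [map_mul, map_mul, hν, hN, one_mul, mul_one]
  have hB₁v : Valued.v (B₁ * ν⁻¹) = Valued.v B₂ * Valued.v p := by rw [hB₁, map_mul, map_mul, map_inv₀, hν, inv_one, mul_one]
  by_contra hgt
  push Not at hgt
  have hB₂pos : 0 < Valued.v B₂ := (Valuation.pos_iff _).2 hB₂
  have t1 : Valued.v (B₁ * ν⁻¹) < Valued.v B₂ := by rw [hB₁v]; exact mul_lt_of_lt_one_right hB₂pos hvp
  have t2 : Valued.v ((A - b + ν * B₂ * σ w) * w) < Valued.v B₂ := by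
    rw [map_mul]; exact lt_of_le_of_lt (by simpa using mul_le_mul' h₂ hwv) hgt
  have t3 : Valued.v ((D - b + ν * B₂ * w) * σ w) < Valued.v B₂ := by
    rw [map_mul]; exact lt_of_le_of_lt (by simpa using mul_le_mul' h₃ hσwv) hgt
  have t4 : Valued.v (B₁ * ν⁻¹ + (A - b) * w + (D - b) * σ w + ν * B₂ * (w * σ w)) < Valued.v B₂ := lt_of_le_of_lt h₄' hgt
  have : Valued.v (ν * B₂ * (w * σ w)) < Valued.v B₂ := by
    rw [key]
    refine lt_of_le_of_lt (Valuation.map_sub _ _ _) (max_lt ?_ t4)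
    refine lt_of_le_of_lt (Valuation.map_add _ _ _) (max_lt ?_ t3)
    exact lt_of_le_of_lt (Valuation.map_add _ _ _) (max_lt t1 t2)
  rw [hvB] at this
  exact lt_irrefl _ this

/-- **Regime `|B₂| ≤ |t|`: (2′)∧(3′) ⟺ `|A − b| ≤ |t| ∧ |D − b| ≤ |t|`** (twin of ★ `two_congruences_iff_of_v_B₂_le`; two eigen-congruences instead of one because `A ≠ D`).
[cite: Flicker1998UnitaryFL, Prop. 10 p. 86] -/
theorem conditions_two_three_iff_of_v_B₂_le {A D b B₂ ν w : K} {m : ℕ} (hB₂m : Valued.v B₂ ≤ Valued.v (ϖ ^ m))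
    (hν : Valued.v ν = 1) (hwv : Valued.v w ≤ 1) (hσwv : Valued.v (σ w) ≤ 1) :
    (Valued.v (A - b + ν * B₂ * σ w) ≤ Valued.v (ϖ ^ m) ∧ Valued.v (D - b + ν * B₂ * w) ≤ Valued.v (ϖ ^ m)) ↔
      (Valued.v (A - b) ≤ Valued.v (ϖ ^ m) ∧ Valued.v (D - b) ≤ Valued.v (ϖ ^ m)) := by
  have h1 : ∀ s : K, Valued.v s ≤ 1 → Valued.v (ν * B₂ * s) ≤ Valued.v (ϖ ^ m) := fun s hs => by
    rw [map_mul, map_mul, hν, one_mul]; simpa using mul_le_mul' hB₂m hs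
  constructor
  · rintro ⟨h₂, h₃⟩
    have eA : A - b = (A - b + ν * B₂ * σ w) - ν * B₂ * σ w := by ring
    have eD : D - b = (D - b + ν * B₂ * w) - ν * B₂ * w := by ring
    exact ⟨by rw [eA]; exact le_trans (Valuation.map_sub _ _ _) (max_le h₂ (h1 _ hσwv)),
      by rw [eD]; exact le_trans (Valuation.map_sub _ _ _) (max_le h₃ (h1 _ hwv))⟩
  · rintro ⟨hA, hD⟩
    exact ⟨le_trans (Valuation.map_add _ _ _) (max_le hA (h1 _ hσwv)), le_trans (Valuation.map_add _ _ _) (max_le hD (h1 _ hwv))⟩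

/-- **Regime «everything solves»**: if `|A − b|, |D − b|, |B₂| ≤ |t|²` then (4′) holds for every unit `ν` and every `w` with `|w|, |σw| ≤ 1`, `|p| ≤ 1`
(twin of ★ `condition_four_of_le_sq`). [cite: Flicker1998UnitaryFL, Prop. 10 p. 86] -/
theorem condition_four_of_le_sq_normForm {A D b B₁ B₂ ν w p : K} {m : ℕ} (hν : Valued.v ν = 1) (hwv : Valued.v w ≤ 1)
    (hσwv : Valued.v (σ w) ≤ 1) (hB₁ : B₁ = B₂ * p) (hvp : Valued.v p ≤ 1)
    (hsA : Valued.v (A - b) ≤ Valued.v (ϖ ^ m) * Valued.v (ϖ ^ m)) (hsD : Valued.v (D - b) ≤ Valued.v (ϖ ^ m) * Valued.v (ϖ ^ m))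
    (hB₂ : Valued.v B₂ ≤ Valued.v (ϖ ^ m) * Valued.v (ϖ ^ m)) :
    Valued.v (B₁ * ν⁻¹ + (A - b) * w + (D - b) * σ w + ν * B₂ * (w * σ w)) ≤ Valued.v (ϖ ^ m) * Valued.v (ϖ ^ m) := by
  have hN : Valued.v (w * σ w) ≤ 1 := by rw [map_mul]; exact mul_le_one' hwv hσwv
  have t1 : Valued.v (B₁ * ν⁻¹) ≤ Valued.v (ϖ ^ m) * Valued.v (ϖ ^ m) := by
    rw [hB₁, map_mul, map_mul, map_inv₀, hν, inv_one, mul_one]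
    exact le_trans (by simpa using mul_le_mul' (le_refl (Valued.v B₂)) hvp) hB₂
  have t2 : Valued.v ((A - b) * w) ≤ Valued.v (ϖ ^ m) * Valued.v (ϖ ^ m) := by
    rw [map_mul]; exact le_trans (by simpa using mul_le_mul' (le_refl (Valued.v (A - b))) hwv) hsA
  have t3 : Valued.v ((D - b) * σ w) ≤ Valued.v (ϖ ^ m) * Valued.v (ϖ ^ m) := by
    rw [map_mul]; exact le_trans (by simpa using mul_le_mul' (le_refl (Valued.v (D - b))) hσwv) hsD
  have t4 : Valued.v (ν * B₂ * (w * σ w)) ≤ Valued.v (ϖ ^ m) * Valued.v (ϖ ^ m) := by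
    rw [map_mul, map_mul, hν, one_mul]; exact le_trans (by simpa using mul_le_mul' (le_refl (Valued.v B₂)) hN) hB₂
  exact le_trans (Valuation.map_add _ _ _) (max_le (le_trans (Valuation.map_add _ _ _)
    (max_le (le_trans (Valuation.map_add _ _ _) (max_le t1 t2)) t3)) t4)

/-- **Regime «no solution», case `|B₂|` dominant**: if `max(|A − b|, |D − b|) < |B₂|` and `|t|² < |B₂|` then (4′) fails — the norm term `νB₂·N(w)` has
valuation `|B₂|` and strictly dominates (`|B₁ν⁻¹| = |B₂||p| < |B₂|`).  One half of the twin of ★ `not_condition_four_of_ne`. [cite: Flicker1998UnitaryFL, Prop. 10 p. 86] -/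
theorem not_condition_four_of_lt_normForm {A D b B₁ B₂ ν w p : K} {m : ℕ} (hB₂0 : B₂ ≠ 0) (hν : Valued.v ν = 1)
    (hwv : Valued.v w ≤ 1) (hσwv : Valued.v (σ w) ≤ 1) (hN : Valued.v (w * σ w) = 1) (hB₁ : B₁ = B₂ * p) (hvp : Valued.v p < 1)
    (hlt : max (Valued.v (A - b)) (Valued.v (D - b)) < Valued.v B₂) (hbig : Valued.v (ϖ ^ m) * Valued.v (ϖ ^ m) < Valued.v B₂) :
    ¬ Valued.v (B₁ * ν⁻¹ + (A - b) * w + (D - b) * σ w + ν * B₂ * (w * σ w)) ≤ Valued.v (ϖ ^ m) * Valued.v (ϖ ^ m) := by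
  intro h₄
  have hB₂pos : 0 < Valued.v B₂ := (Valuation.pos_iff _).2 hB₂0
  have vZ : Valued.v (ν * B₂ * (w * σ w)) = Valued.v B₂ := by rw [map_mul, map_mul, hν, hN, one_mul, mul_one]
  have t1 : Valued.v (B₁ * ν⁻¹) < Valued.v B₂ := by
    rw [hB₁, map_mul, map_mul, map_inv₀, hν, inv_one, mul_one]; exact mul_lt_of_lt_one_right hB₂pos hvp
  have t2 : Valued.v ((A - b) * w) < Valued.v B₂ := by
    rw [map_mul]; exact lt_of_le_of_lt (by simpa using mul_le_mul' (le_refl (Valued.v (A - b))) hwv) (lt_of_le_of_lt (le_max_left _ _) hlt)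
  have t3 : Valued.v ((D - b) * σ w) < Valued.v B₂ := by
    rw [map_mul]; exact lt_of_le_of_lt (by simpa using mul_le_mul' (le_refl (Valued.v (D - b))) hσwv) (lt_of_le_of_lt (le_max_right _ _) hlt)
  have hrest : Valued.v (B₁ * ν⁻¹ + (A - b) * w + (D - b) * σ w) < Valued.v (ν * B₂ * (w * σ w)) := by
    rw [vZ]
    exact lt_of_le_of_lt (Valuation.map_add _ _ _) (max_lt (lt_of_le_of_lt (Valuation.map_add _ _ _) (max_lt t1 t2)) t3)
  have hsum : Valued.v (B₁ * ν⁻¹ + (A - b) * w + (D - b) * σ w + ν * B₂ * (w * σ w)) = Valued.v B₂ := by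
    rw [Valuation.map_add_eq_of_lt_right _ hrest, vZ]
  rw [hsum] at h₄
  exact absurd (lt_of_lt_of_le hbig h₄) (lt_irrefl _)

/-- **Regime «no solution», case `|A − b| ≠ |D − b|` dominant**: if `|A − b| ≠ |D − b|`, `|B₂| < max(|A − b|, |D − b|)` and `|t|² < max(|A − b|, |D − b|)`, with
`|w| = |σw| = 1`, then (4′) fails (the two linear terms cannot cancel; the other half of ★ `not_condition_four_of_ne`; the equal-size case `|A − b| = |D − b|` reads the
literal and belongs to block (C3b)). [cite: Flicker1998UnitaryFL, Prop. 10 p. 86] -/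
theorem not_condition_four_of_ne_normForm {A D b B₁ B₂ ν w p : K} {m : ℕ} (hν : Valued.v ν = 1)
    (hw1 : Valued.v w = 1) (hσw1 : Valued.v (σ w) = 1) (hB₁ : B₁ = B₂ * p) (hvp : Valued.v p ≤ 1)
    (hne : Valued.v (A - b) ≠ Valued.v (D - b))
    (hB₂ : Valued.v B₂ < max (Valued.v (A - b)) (Valued.v (D - b)))
    (hbig : Valued.v (ϖ ^ m) * Valued.v (ϖ ^ m) < max (Valued.v (A - b)) (Valued.v (D - b))) :
    ¬ Valued.v (B₁ * ν⁻¹ + (A - b) * w + (D - b) * σ w + ν * B₂ * (w * σ w)) ≤ Valued.v (ϖ ^ m) * Valued.v (ϖ ^ m) := by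
  intro h₄
  have vA : Valued.v ((A - b) * w) = Valued.v (A - b) := by rw [map_mul, hw1, mul_one]
  have vD : Valued.v ((D - b) * σ w) = Valued.v (D - b) := by rw [map_mul, hσw1, mul_one]
  have vZ : Valued.v (ν * B₂ * (w * σ w)) = Valued.v B₂ := by rw [map_mul, map_mul, map_mul, hν, hw1, hσw1, one_mul, mul_one, mul_one]
  have t1 : Valued.v (B₁ * ν⁻¹) ≤ Valued.v B₂ := by
    rw [hB₁, map_mul, map_mul, map_inv₀, hν, inv_one, mul_one]; simpa using mul_le_mul' (le_refl (Valued.v B₂)) hvp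
  -- the linear part has valuation `max(|A−b|, |D−b|)` (isosceles with unequal sides)
  have hlin : Valued.v ((A - b) * w + (D - b) * σ w) = max (Valued.v (A - b)) (Valued.v (D - b)) := by
    rcases lt_or_gt_of_ne hne with h | h
    · rw [Valuation.map_add_eq_of_lt_right _ (by rw [vA, vD]; exact h), vD, max_eq_right h.le]
    · rw [Valuation.map_add_eq_of_lt_left _ (by rw [vA, vD]; exact h), vA, max_eq_left h.le]
  have hsum : Valued.v (B₁ * ν⁻¹ + (A - b) * w + (D - b) * σ w + ν * B₂ * (w * σ w)) = max (Valued.v (A - b)) (Valued.v (D - b)) := by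
    have e : B₁ * ν⁻¹ + (A - b) * w + (D - b) * σ w + ν * B₂ * (w * σ w) =
        ((A - b) * w + (D - b) * σ w) + (B₁ * ν⁻¹ + ν * B₂ * (w * σ w)) := by ring
    have hsmall : Valued.v (B₁ * ν⁻¹ + ν * B₂ * (w * σ w)) < max (Valued.v (A - b)) (Valued.v (D - b)) :=
      lt_of_le_of_lt (Valuation.map_add _ _ _) (max_lt (lt_of_le_of_lt t1 hB₂) (by rw [vZ]; exact hB₂))
    rw [e, Valuation.map_add_eq_of_lt_left _ (by rw [hlin]; exact hsmall), hlin]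
  rw [hsum] at h₄
  exact absurd (lt_of_lt_of_le hbig h₄) (lt_irrefl _)

/-- **Regime `ν = N₊ < 2m`: (4′) is a QUADRATIC CONGRUENCE in the norm `ν = uσu`**:
`B₁ν⁻¹ + (A−b)w + (D−b)σw + νB₂·wσw = (B₂ν⁻¹)·(ν²·wσw + d·ν + p)` with `d = ((A−b)w + (D−b)σw)∕B₂`, `B₁ = B₂p`; so for a unit `ν`,
(4′) ⟺ `|B₂|·|ν²·wσw + dν + p| ≤ |t|²` (twin of ★ `condition_four_iff_quadratic`: `1 − x² ↦ wσw`, `2(A−b) ↦ (A−b)w + (D−b)σw`, `ϖ^{2j} ↦ p`).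
[cite: Flicker1998UnitaryFL, Prop. 10 p. 86] -/
theorem condition_four_iff_quadratic_normForm {A D b B₁ B₂ ν w p : K} {m : ℕ} (hB₂0 : B₂ ≠ 0) (hν : Valued.v ν = 1) (hB₁ : B₁ = B₂ * p) :
    Valued.v (B₁ * ν⁻¹ + (A - b) * w + (D - b) * σ w + ν * B₂ * (w * σ w)) ≤ Valued.v (ϖ ^ m) * Valued.v (ϖ ^ m) ↔
      Valued.v B₂ * Valued.v (ν ^ 2 * (w * σ w) + (((A - b) * w + (D - b) * σ w) / B₂) * ν + p) ≤
        Valued.v (ϖ ^ m) * Valued.v (ϖ ^ m) := by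
  have hν0 : ν ≠ 0 := fun h => by rw [h, map_zero] at hν; exact zero_ne_one hν
  have e : B₁ * ν⁻¹ + (A - b) * w + (D - b) * σ w + ν * B₂ * (w * σ w) =
      (B₂ * ν⁻¹) * (ν ^ 2 * (w * σ w) + (((A - b) * w + (D - b) * σ w) / B₂) * ν + p) := by
    rw [hB₁]; field_simp; ring
  rw [e, map_mul, map_mul, map_inv₀, hν, inv_one, mul_one]

/-- **Uniqueness of the norm class in the regime `ν = N₊ < 2m`**: two unit solutions `n₁, n₂` of `|n²c + dn + p| ≤ |ϖ^k|` (`k ≥ 1`, `|c| = 1`, `|p| < 1`) agree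
modulo `ϖ^k`: `E(n₁) − E(n₂) = (n₁ − n₂)·((n₁+n₂)c + d)` and the bracket is a unit because `d ≡ −n₁c − p∕n₁` (twin of ★ `v_sub_le_of_quadratic`: `1 − x² ↦ c`,
`ϖ^{2j} ↦ p`). [cite: Flicker1998UnitaryFL, Prop. 10 p. 86] -/
theorem v_sub_le_of_quadratic_normForm (hd : UnramifiedLocalConjDatum σ ϖ) {n₁ n₂ c d p : K} {k : ℕ} (hk : 1 ≤ k)
    (hn₁ : Valued.v n₁ = 1) (hn₂ : Valued.v n₂ = 1) (hc : Valued.v c = 1) (hvp : Valued.v p < 1)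
    (hE₁ : Valued.v (n₁ ^ 2 * c + d * n₁ + p) ≤ Valued.v (ϖ ^ k))
    (hE₂ : Valued.v (n₂ ^ 2 * c + d * n₂ + p) ≤ Valued.v (ϖ ^ k)) :
    Valued.v (n₁ - n₂) ≤ Valued.v (ϖ ^ k) := by
  have hn₁0 : n₁ ≠ 0 := fun h => by rw [h, map_zero] at hn₁; exact zero_ne_one hn₁
  set E₁ := n₁ ^ 2 * c + d * n₁ + p with hE₁def
  set E₂ := n₂ ^ 2 * c + d * n₂ + p with hE₂def
  have hbr : (n₁ + n₂) * c + d = n₂ * c + (E₁ - p) * n₁⁻¹ := by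
    rw [hE₁def]; field_simp; ring
  have hk1 : Valued.v (ϖ ^ k) < 1 := by rw [hd.v_pow, ← WithZero.exp_zero, WithZero.exp_lt_exp]; omega
  have hsmall : Valued.v ((E₁ - p) * n₁⁻¹) < 1 := by
    rw [map_mul, map_inv₀, hn₁, inv_one, mul_one]
    exact lt_of_le_of_lt (Valuation.map_sub _ _ _) (max_lt (lt_of_le_of_lt hE₁ hk1) hvp)
  have hmain : Valued.v (n₂ * c) = 1 := by rw [map_mul, hn₂, hc, one_mul]
  have hunit : Valued.v ((n₁ + n₂) * c + d) = 1 := by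
    rw [hbr, Valuation.map_add_eq_of_lt_left _ (by rw [hmain]; exact hsmall), hmain]
  have hfac : E₁ - E₂ = (n₁ - n₂) * ((n₁ + n₂) * c + d) := by rw [hE₁def, hE₂def]; ring
  have hdiff : Valued.v (E₁ - E₂) ≤ Valued.v (ϖ ^ k) := le_trans (Valuation.map_sub _ _ _) (max_le hE₁ hE₂)
  rw [hfac, map_mul, hunit, mul_one] at hdiff
  exact hdiff

end UnitaryGroup

end Literature.NumberTheory.Automorphic
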